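import Summits.SmoothPoincare4.SmoothPoincare4.Theses.DiophantineRotations
import HarnessLib
import HarnessLib.Audit

/-!
# Birth skeleton (BC3) for crux `DiophantineRotations.DiophantineRigidity` (item stmt-SmoothPoincare4-16607)

Line `birth` — ISOMETRISE, THEN CLASSIFY (the Haar-averaged isometrisation chain: Herman-type rigidity is
isolated as "the quasi-periodic diffeomorphism preserves a smooth Riemannian metric"; everything after that is
compact transformation groups).

THE CRUX (verbatim the route decl `Summit.SmoothPoincare4.SmoothPoincare4.Theses.DiophantineRotations.DiophantineRigidity`,
rank 2, K1 of the route): for every smooth 4-manifold `M` (SPC4 binders), every diffeomorphism `F : M ≃ₘ M`, every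
homeomorphism `h : M ≃ₜ S⁴` and every simultaneously Diophantine pair `(α, β)` with `h ∘ F = R_{α,β} ∘ h`
pointwise (`R_{α,β}` = the linear bi-rotation of the round `S⁴ ⊂ ℂ² ⊕ ℝ`, coordinates written out), there is a
diffeomorphism `θ : M ≃ₘ S⁴` with `θ ∘ F = R_{α,β} ∘ θ`.

THE LINE. A diffeomorphism that is `C⁰`-conjugate to the Diophantine bi-rotation is smoothly conjugate to it as
soon as it is an ISOMETRY of some smooth metric: then the closure `T` of `{Fⁿ}` in `Isom(M, g)` is a compact
abelian Lie group acting smoothly (Myers–Steenrod), `h` conjugates `T` onto the closure of `{Rⁿ}` in `Homeo(S⁴)`,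
which is the LINEAR 2-torus because `1, α, β` are rationally independent (forced by the Diophantine condition:
`k₁α + k₂β + m = 0` would give `γ ≤ 0`), so the transported linear torus action `t ↦ h⁻¹ ∘ L_t ∘ h` is a SMOOTH
effective `T²`-action on `M`, `C⁰`-conjugate to the linear one and containing `F = h⁻¹ L_{t₀} h`,
`t₀ = (e^{2πiα}, e^{2πiβ})`; and smooth effective `T²`-actions on closed 4-manifolds are classified up to
equivariant diffeomorphism by their weighted orbit space (Orlik–Raymond 1970; Pao 1977 for homotopy 4-spheres),
which `h` identifies with that of the linear action INCLUDING the identification of the acting torus, so there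
is an equivariant diffeomorphism `θ : M → S⁴`, in particular `θ ∘ F = R_{α,β} ∘ θ`. What carries the Herman /
KAM content is the first step alone: "a smooth map that rotates quasi-periodically with Diophantine frequencies,
in the `C⁰` sense, has uniformly `C^k`-bounded iterates", i.e. preserves a smooth metric (average any metric over
the compact `C^∞`-closure of `{Fⁿ}`). This is the refuter's recorded equivalence `K1 ⟺ ({Fⁿ} uniformly
C^k-bounded ∀ k) ∧ (smooth T²-actions on homotopy S⁴ standard)` (R1-review, 2026-08-16) cut into its two
factors, with the Myers–Steenrod/Kronecker passage between them made a named step, and it is the TRANSFER of the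
crux idea `haar-averaged-isometrisation` (idea-node g14, evidence on the item): `C⁺ = DiophantineIsometrisation`
is STUB 1.

* STUB 1 `stub_isometrisation` — DIOPHANTINE ISOMETRISATION (the load-bearing, open stub; Herman's `C⁰ ⇒ C^∞`
  problem two dimensions up): under the crux hypotheses `F` preserves some `C^∞` Riemannian metric `g` on `M`
  (a `Bundle.ContMDiffRiemannianMetric` on the tangent bundle with `g(Fx)(dF v, dF w) = g(x)(v, w)`, the
  isometry clause of the route's support item `NoIdling` verbatim). It is NOT the crux: its output is a metric,
  not a conjugacy, and `M` is not recognised (BC3 probes fail). It IS implied by the crux (pull the round metric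
  back along `θ`), as a transfer target should be. Uses the arithmetic essentially (Anosov–Katok / Fayad–Saprykina
  Liouville examples preserve no smooth metric).
* STUB 2 `stub_torusExtension` — FROM AN INVARIANT METRIC TO THE SMOOTH TORUS (Myers–Steenrod + Kronecker; known
  in substance, Lean size L–XL: isometry groups of Riemannian manifolds are not in Mathlib): under the crux
  hypotheses plus an `F`-invariant smooth metric, there is a jointly `C^∞` map `Φ : T² × M → M`
  (`T² = Circle × Circle`, model `((𝓡 1).prod (𝓡 1)).prod (𝓡 4)`) intertwined by `h` with the LINEAR torus
  action `L_{(z,w)}(x) = (z·(x₀+ix₁), w·(x₂+ix₃), x₄)` of `S⁴`: `h (Φ (z,w) x) = L_{(z,w)} (h x)`. (Group law,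
  effectivity and `Φ t₀ = F` follow from the intertwining through the bijection `h`; they are not restated.)
  Uses the arithmetic only through `1, α, β` being ℚ-independent. NOT the crux: no conjugating diffeomorphism
  is produced, and without STUB 1 its metric hypothesis is unavailable.
* STUB 3 `stub_equivariantLinearisation` — SMOOTH TORUS ACTIONS ON HOMOTOPY 4-SPHERES THAT ARE TOPOLOGICALLY
  LINEAR ARE SMOOTHLY LINEAR (Orlik–Raymond equivariant classification, strict form; Lean size XL): for `M`, `F`,
  `h`, ARBITRARY reals `α, β` with `h ∘ F = R_{α,β} ∘ h`, and a jointly smooth `Φ : T² × M → M` intertwined by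
  `h` with the linear torus action, there is a diffeomorphism `θ : M ≃ₘ S⁴` with `θ ∘ F = R_{α,β} ∘ θ` (the crux
  conclusion verbatim). No arithmetic: pure 4-dimensional compact transformation groups (the weighted orbit
  data of `Φ` are those of the linear action because `h` is an equivariant homeomorphism, two fixed points,
  isotropy circles `S¹ × 1`, `1 × S¹`; the classification gives an equivariant DIFFEOMORPHISM inducing the
  identity of `T²`, and `F = Φ_{t₀}`). NOT the crux: it needs the smooth torus `Φ`, which a bare `C⁰`
  conjugacy does not provide; NOT the summit: an arbitrary homotopy 4-sphere carries no such `Φ`.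

COMPOSITION (kernel-checked, no `sorry` outside the three stubs): `diophantineRigidity_of_stubs :
<stub₁-sig> → <stub₂-sig> → <stub₃-sig> → <the crux statement>` is four lines of logic (metric from STUB 1,
torus from STUB 2, conjugacy from STUB 3), and THE skeleton theorem
`DiophantineRigidity_of : DiophantineRotations.DiophantineRigidity` — the crux BY NAME — is
`diophantineRigidity_of_stubs stub_isometrisation stub_torusExtension stub_equivariantLinearisation`.

DISPROOF USED: no `Disproof.lean` exists for this crux (`ledger crux ls stmt-SmoothPoincare4-16607`: no
workfiles, 2026-08-17); negatives index SmoothPoincare4: nothing refuted is reused. The route's own expected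
obstruction `_false_without_Diophantine` (Liouville frequencies: Anosov–Katok / Herman ch. XI) is honoured at
STUB 1 (and STUB 2), which keep the Diophantine hypothesis verbatim; STUB 3 is arithmetic-free by design and
true for rational angles as well (finite-order case = equivariant classification again). Refuter route-review
R1 (2026-08-16): the crux is non-vacuous (`M = S⁴`, `F = R`, `h = id`), `F = id` is excluded (`α ∉ ℤ`); the same
witnesses inhabit every stub in kind (`g` = round metric, `Φ` = the linear action, `θ = id`).

BARRIERS: `CircleActionBarrierFour` (Fintushel–Pao: symmetry ⇒ standard, by compactness) is exactly the ENGINE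
of STUB 3 and is reached only after STUB 1 has produced compactness from arithmetic — the line concedes that the
endpoint is classical and puts all novelty in STUB 1; `TopologicalBarrierFour`: nothing is computed from the
TOP manifold, `h` enters only as an intertwiner whose regularity is upgraded; `ProjectiveRigidityBarrierFour`:
finite-order maps excluded at STUB 1–2 by the Diophantine condition; gauge / h-cobordism barriers not engaged.
-/

noncomputable section

open scoped Manifold ContDiff Topology

namespace Summit.SmoothPoincare4.SmoothPoincare4.Cruxes.DiophantineRigidity.Birth

set_option linter.dupNamespace false
set_option linter.unusedVariables false

/-! ## The three registered stubs (`sorry` lives ONLY here; signatures over Mathlib + the route file only) -/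

/-- STUB 1 (registered) — DIOPHANTINE ISOMETRISATION: under the hypotheses of the crux (smooth 4-manifold `M`,
diffeomorphism `F`, homeomorphism `h : M ≃ₜ S⁴`, simultaneously Diophantine `(α, β)`, `h ∘ F = R_{α,β} ∘ h`), the
diffeomorphism `F` preserves a `C^∞` Riemannian metric on `M`. Size: open problem (the hardest stub; Herman's
global `C⁰ ⇒ C^∞` rigidity question in dimension four, equivalently uniform `C^k` bounds on the iterates `Fⁿ`).
Why plausibly true: dimension one is Herman–Yoccoz; no `C^∞` map `C⁰`-conjugate to a DIOPHANTINE rotation and not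
`C¹`-conjugate to it is known in any dimension; KAM gives it near `R`.
[cite: Herman1979; Yoccoz1984; FayadKrikorian2009; arXiv:1708.02529; arXiv:1509.06906] -/
theorem stub_isometrisation :
    ∀ (M : Type) [TopologicalSpace M] [T2Space M] [SecondCountableTopology M] [ChartedSpace (EuclideanSpace ℝ (Fin 4)) M] [IsManifold (𝓡 4) (⊤ : ℕ∞) M] (F : Diffeomorph (𝓡 4) (𝓡 4) M M (⊤ : ℕ∞)) (h : M ≃ₜ Metric.sphere (0 : EuclideanSpace ℝ (Fin 5)) 1) (α β : ℝ), (∃ γ τ : ℝ, 0 < γ ∧ ∀ k₁ k₂ m : ℤ, (k₁ ≠ 0 ∨ k₂ ≠ 0) → γ ≤ |(k₁ : ℝ) * α + (k₂ : ℝ) * β + (m : ℝ)| * (|(k₁ : ℝ)| + |(k₂ : ℝ)|) ^ τ) → (∀ x : M, ((h (F x) : Metric.sphere (0 : EuclideanSpace ℝ (Fin 5)) 1) : EuclideanSpace ℝ (Fin 5)) = WithLp.toLp 2 ![Real.cos (2 * Real.pi * α) * (h x : EuclideanSpace ℝ (Fin 5)) 0 - Real.sin (2 * Real.pi * α) * (h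 x : EuclideanSpace ℝ (Fin 5)) 1, Real.sin (2 * Real.pi * α) * (h x : EuclideanSpace ℝ (Fin 5)) 0 + Real.cos (2 * Real.pi * α) * (h x : EuclideanSpace ℝ (Fin 5)) 1, Real.cos (2 * Real.pi * β) * (h x : EuclideanSpace ℝ (Fin 5)) 2 - Real.sin (2 * Real.pi * β) * (h x : EuclideanSpace ℝ (Fin 5)) 3, Real.sin (2 * Real.pi * β) * (h x : EuclideanSpace ℝ (Fin 5)) 2 + Real.cos (2 * Real.pi * β) * (h x : EuclideanSpace ℝ (Fin 5)) 3, (h x : EuclideanSpace ℝ (Fin 5)) 4]) → ∃ g : Bundle.ContMDiffRiemannianMetric (𝓡 4) (⊤ : ℕ∞) (EuclideanSpace ℝ (Fin 4)) (fun x : M => TangentSpace (𝓡 4) x), ∀ (x : M) (v w : TangentSpace (𝓡 4) x), g.inner (F x) (mfderiv (𝓡 4) (𝓡 4) F x v) (mfderiv (𝓡 4) (𝓡 4) F x w) = g.inner x v w := by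
  sorry

/-- STUB 2 (registered) — TORUS EXTENSION (Myers–Steenrod + Kronecker): under the crux hypotheses, if `F`
preserves a smooth Riemannian metric `g`, then the linear torus action of `S⁴` transported by `h` is a jointly
smooth map `Φ : (Circle × Circle) × M → M` with `h (Φ (z, w) x) = L_{(z,w)} (h x)`. Proof route: `Isom(M, g)` is a
compact Lie group acting smoothly; the closure `T` of `{Fⁿ}` is compact, hence closed in `Homeo(M)`; conjugation
by `h` carries it onto the closure of `{Rⁿ}` in `Homeo(S⁴)`, which is the linear `T²` because `1, α, β` are
ℚ-independent (Diophantine ⇒ `k₁α + k₂β + m ≠ 0`); a continuous homomorphism `T² → Isom(M, g)` is smooth, and the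
evaluation `Isom(M, g) × M → M` is smooth. Size: L–XL (Myers–Steenrod is not in Mathlib).
[cite: MyersSteenrod1939; Palais1970; Herman1979] -/
theorem stub_torusExtension :
    ∀ (M : Type) [TopologicalSpace M] [T2Space M] [SecondCountableTopology M] [ChartedSpace (EuclideanSpace ℝ (Fin 4)) M] [IsManifold (𝓡 4) (⊤ : ℕ∞) M] (F : Diffeomorph (𝓡 4) (𝓡 4) M M (⊤ : ℕ∞)) (h : M ≃ₜ Metric.sphere (0 : EuclideanSpace ℝ (Fin 5)) 1) (α β : ℝ), (∃ γ τ : ℝ, 0 < γ ∧ ∀ k₁ k₂ m : ℤ, (k₁ ≠ 0 ∨ k₂ ≠ 0) → γ ≤ |(k₁ : ℝ) * α + (k₂ : ℝ) * β + (m : ℝ)| * (|(k₁ : ℝ)| + |(k₂ : ℝ)|) ^ τ) → (∀ x : M, ((h (F x) : Metric.sphere (0 : EuclideanSpace ℝ (Fin 5)) 1) : EuclideanSpace ℝ (Fin 5)) = WithLp.toLp 2 ![Real.cos (2 * Real.pi * α) * (h x : EuclideanSpace ℝ (Fin 5)) 0 - Real.sin (2 * Real.pi * α) * (h x : EuclideanSpace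 ℝ (Fin 5)) 1, Real.sin (2 * Real.pi * α) * (h x : EuclideanSpace ℝ (Fin 5)) 0 + Real.cos (2 * Real.pi * α) * (h x : EuclideanSpace ℝ (Fin 5)) 1, Real.cos (2 * Real.pi * β) * (h x : EuclideanSpace ℝ (Fin 5)) 2 - Real.sin (2 * Real.pi * β) * (h x : EuclideanSpace ℝ (Fin 5)) 3, Real.sin (2 * Real.pi * β) * (h x : EuclideanSpace ℝ (Fin 5)) 2 + Real.cos (2 * Real.pi * β) * (h x : EuclideanSpace ℝ (Fin 5)) 3, (h x : EuclideanSpace ℝ (Fin 5)) 4]) → ∀ (g : Bundle.ContMDiffRiemannianMetric (𝓡 4) (⊤ : ℕ∞) (EuclideanSpace ℝ (Fin 4)) (fun x : M => TangentSpace (𝓡 4) x)), (∀ (x : M) (v w : TangentSpace (𝓡 4) x), g.inner (F x) (mfderiv (𝓡 4) (𝓡 4) F x v) (mfderiv (𝓡 4) (𝓡 4) F x w) = g.inner x v w) → ∃ Φ : Circle × Circle → M → M, ContMDiff (((𝓡 1).prod (𝓡 1)).prod (𝓡 4)) (𝓡 4) (⊤ : ℕ∞) (fun p : (Circle × Circle)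 × M => Φ p.1 p.2) ∧ ∀ (z w : Circle) (x : M), ((h (Φ (z, w) x) : Metric.sphere (0 : EuclideanSpace ℝ (Fin 5)) 1) : EuclideanSpace ℝ (Fin 5)) = WithLp.toLp 2 ![(z : ℂ).re * (h x : EuclideanSpace ℝ (Fin 5)) 0 - (z : ℂ).im * (h x : EuclideanSpace ℝ (Fin 5)) 1, (z : ℂ).im * (h x : EuclideanSpace ℝ (Fin 5)) 0 + (z : ℂ).re * (h x : EuclideanSpace ℝ (Fin 5)) 1, (w : ℂ).re * (h x : EuclideanSpace ℝ (Fin 5)) 2 - (w : ℂ).im * (h x : EuclideanSpace ℝ (Fin 5)) 3, (w : ℂ).im * (h x : EuclideanSpace ℝ (Fin 5)) 2 + (w : ℂ).re * (h x : EuclideanSpace ℝ (Fin 5)) 3, (h x : EuclideanSpace ℝ (Fin 5)) 4] := by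
  sorry

/-- STUB 3 (registered) — EQUIVARIANT LINEARISATION (Orlik–Raymond, strict form): a smooth 4-manifold `M`
with a homeomorphism `h : M ≃ₜ S⁴`, a diffeomorphism `F` with `h ∘ F = R_{α,β} ∘ h` (ANY real `α, β`), and a
jointly smooth `Φ : (Circle × Circle) × M → M` intertwined by `h` with the linear torus action of `S⁴`, admits a
diffeomorphism `θ : M ≃ₘ S⁴` with `θ ∘ F = R_{α,β} ∘ θ`. Proof route: `Φ` is a smooth effective `T²`-action (laws
through the bijection `h`) with the weighted orbit space of the linear action and the SAME identification of the
acting torus; the equivariant classification of smooth `T²`-actions on closed 4-manifolds gives an equivariant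
diffeomorphism `θ` (identity on `T²`), and `F = Φ_{t₀}`, `t₀ = (e^{2πiα}, e^{2πiβ})`. Size: XL (compact
transformation groups in dimension four; no arithmetic). [cite: OrlikRaymond1970; Pao1977; Fintushel1978; Pao1978] -/
theorem stub_equivariantLinearisation :
    ∀ (M : Type) [TopologicalSpace M] [T2Space M] [SecondCountableTopology M] [ChartedSpace (EuclideanSpace ℝ (Fin 4)) M] [IsManifold (𝓡 4) (⊤ : ℕ∞) M] (F : Diffeomorph (𝓡 4) (𝓡 4) M M (⊤ : ℕ∞)) (h : M ≃ₜ Metric.sphere (0 : EuclideanSpace ℝ (Fin 5)) 1) (α β : ℝ), (∀ x : M, ((h (F x) : Metric.sphere (0 : EuclideanSpace ℝ (Fin 5)) 1) : EuclideanSpace ℝ (Fin 5)) = WithLp.toLp 2 ![Real.cos (2 * Real.pi * α) * (h x : EuclideanSpace ℝ (Fin 5)) 0 - Real.sin (2 * Real.pi * α) * (h x : EuclideanSpace ℝ (Fin 5)) 1, Real.sin (2 * Real.pi * α) * (h x : EuclideanSpace ℝ (Fin 5)) 0 + Real.cos (2 * Real.pi * α) * (h x : EuclideanSpace ℝ (Fin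 5)) 1, Real.cos (2 * Real.pi * β) * (h x : EuclideanSpace ℝ (Fin 5)) 2 - Real.sin (2 * Real.pi * β) * (h x : EuclideanSpace ℝ (Fin 5)) 3, Real.sin (2 * Real.pi * β) * (h x : EuclideanSpace ℝ (Fin 5)) 2 + Real.cos (2 * Real.pi * β) * (h x : EuclideanSpace ℝ (Fin 5)) 3, (h x : EuclideanSpace ℝ (Fin 5)) 4]) → ∀ (Φ : Circle × Circle → M → M), ContMDiff (((𝓡 1).prod (𝓡 1)).prod (𝓡 4)) (𝓡 4) (⊤ : ℕ∞) (fun p : (Circle × Circle) × M => Φ p.1 p.2) → (∀ (z w : Circle) (x : M), ((h (Φ (z, w) x) : Metric.sphere (0 : EuclideanSpace ℝ (Fin 5)) 1) : EuclideanSpace ℝ (Fin 5)) = WithLp.toLp 2 ![(z : ℂ).re * (h x : EuclideanSpace ℝ (Fin 5)) 0 - (z : ℂ).im * (h x : EuclideanSpace ℝ (Fin 5)) 1, (z : ℂ).im * (h x : EuclideanSpace ℝ (Fin 5)) 0 + (z : ℂ).re * (h x : EuclideanSpace ℝ (Fin 5)) 1, (w : ℂ).re * (h x : EuclideanSpace ℝ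 (Fin 5)) 2 - (w : ℂ).im * (h x : EuclideanSpace ℝ (Fin 5)) 3, (w : ℂ).im * (h x : EuclideanSpace ℝ (Fin 5)) 2 + (w : ℂ).re * (h x : EuclideanSpace ℝ (Fin 5)) 3, (h x : EuclideanSpace ℝ (Fin 5)) 4]) → ∃ θ : Diffeomorph (𝓡 4) (𝓡 4) M (Metric.sphere (0 : EuclideanSpace ℝ (Fin 5)) 1) (⊤ : ℕ∞), ∀ x : M, ((θ (F x) : Metric.sphere (0 : EuclideanSpace ℝ (Fin 5)) 1) : EuclideanSpace ℝ (Fin 5)) = WithLp.toLp 2 ![Real.cos (2 * Real.pi * α) * (θ x : EuclideanSpace ℝ (Fin 5)) 0 - Real.sin (2 * Real.pi * α) * (θ x : EuclideanSpace ℝ (Fin 5)) 1, Real.sin (2 * Real.pi * α) * (θ x : EuclideanSpace ℝ (Fin 5)) 0 + Real.cos (2 * Real.pi * α) * (θ x : EuclideanSpace ℝ (Fin 5)) 1, Real.cos (2 * Real.pi * β) * (θ x : EuclideanSpace ℝ (Fin 5)) 2 - Real.sin (2 * Real.pi * β) * (θ x : EuclideanSpace ℝ (Fin 5)) 3, Real.sin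 (2 * Real.pi * β) * (θ x : EuclideanSpace ℝ (Fin 5)) 2 + Real.cos (2 * Real.pi * β) * (θ x : EuclideanSpace ℝ (Fin 5)) 3, (θ x : EuclideanSpace ℝ (Fin 5)) 4] := by
  sorry

/-! ## Composition: stubs ⟹ crux (no `sorry` below this line) -/

/-- **Isometrise, then classify — arrow form.** STUB 1 gives an `F`-invariant smooth metric, STUB 2 turns it
into the smooth transported torus `Φ`, STUB 3 conjugates `F` smoothly to `R_{α,β}`; the conclusion is the
statement of `DiophantineRigidity` spelled out (definitionally the route decl). -/
theorem diophantineRigidity_of_stubs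
    (h₁ :
      ∀ (M : Type) [TopologicalSpace M] [T2Space M] [SecondCountableTopology M] [ChartedSpace (EuclideanSpace ℝ (Fin 4)) M] [IsManifold (𝓡 4) (⊤ : ℕ∞) M] (F : Diffeomorph (𝓡 4) (𝓡 4) M M (⊤ : ℕ∞)) (h : M ≃ₜ Metric.sphere (0 : EuclideanSpace ℝ (Fin 5)) 1) (α β : ℝ), (∃ γ τ : ℝ, 0 < γ ∧ ∀ k₁ k₂ m : ℤ, (k₁ ≠ 0 ∨ k₂ ≠ 0) → γ ≤ |(k₁ : ℝ) * α + (k₂ : ℝ) * β + (m : ℝ)| * (|(k₁ : ℝ)| + |(k₂ : ℝ)|) ^ τ) → (∀ x : M, ((h (F x) : Metric.sphere (0 : EuclideanSpace ℝ (Fin 5)) 1) : EuclideanSpace ℝ (Fin 5)) = WithLp.toLp 2 ![Real.cos (2 * Real.pi * α) * (h x : EuclideanSpace ℝ (Fin 5)) 0 - Real.sin (2 * Real.pi * α) * (h x : EuclideanSpace ℝ (Fin 5)) 1, Real.sin (2 * Real.pi * α) * (h x : EuclideanSpace ℝ (Fin 5)) 0 + Real.cos (2 * Real.pi * α) * (h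 x : EuclideanSpace ℝ (Fin 5)) 1, Real.cos (2 * Real.pi * β) * (h x : EuclideanSpace ℝ (Fin 5)) 2 - Real.sin (2 * Real.pi * β) * (h x : EuclideanSpace ℝ (Fin 5)) 3, Real.sin (2 * Real.pi * β) * (h x : EuclideanSpace ℝ (Fin 5)) 2 + Real.cos (2 * Real.pi * β) * (h x : EuclideanSpace ℝ (Fin 5)) 3, (h x : EuclideanSpace ℝ (Fin 5)) 4]) → ∃ g : Bundle.ContMDiffRiemannianMetric (𝓡 4) (⊤ : ℕ∞) (EuclideanSpace ℝ (Fin 4)) (fun x : M => TangentSpace (𝓡 4) x), ∀ (x : M) (v w : TangentSpace (𝓡 4) x), g.inner (F x) (mfderiv (𝓡 4) (𝓡 4) F x v) (mfderiv (𝓡 4) (𝓡 4) F x w) = g.inner x v w)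
    (h₂ :
      ∀ (M : Type) [TopologicalSpace M] [T2Space M] [SecondCountableTopology M] [ChartedSpace (EuclideanSpace ℝ (Fin 4)) M] [IsManifold (𝓡 4) (⊤ : ℕ∞) M] (F : Diffeomorph (𝓡 4) (𝓡 4) M M (⊤ : ℕ∞)) (h : M ≃ₜ Metric.sphere (0 : EuclideanSpace ℝ (Fin 5)) 1) (α β : ℝ), (∃ γ τ : ℝ, 0 < γ ∧ ∀ k₁ k₂ m : ℤ, (k₁ ≠ 0 ∨ k₂ ≠ 0) → γ ≤ |(k₁ : ℝ) * α + (k₂ : ℝ) * β + (m : ℝ)| * (|(k₁ : ℝ)| + |(k₂ : ℝ)|) ^ τ) → (∀ x : M, ((h (F x) : Metric.sphere (0 : EuclideanSpace ℝ (Fin 5)) 1) : EuclideanSpace ℝ (Fin 5)) = WithLp.toLp 2 ![Real.cos (2 * Real.pi * α) * (h x : EuclideanSpace ℝ (Fin 5)) 0 - Real.sin (2 * Real.pi * α) * (h x : EuclideanSpace ℝ (Fin 5)) 1, Real.sin (2 * Real.pi * α) * (h x : EuclideanSpace ℝ (Fin 5)) 0 + Real.cos (2 * Real.pi * α) * (h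 x : EuclideanSpace ℝ (Fin 5)) 1, Real.cos (2 * Real.pi * β) * (h x : EuclideanSpace ℝ (Fin 5)) 2 - Real.sin (2 * Real.pi * β) * (h x : EuclideanSpace ℝ (Fin 5)) 3, Real.sin (2 * Real.pi * β) * (h x : EuclideanSpace ℝ (Fin 5)) 2 + Real.cos (2 * Real.pi * β) * (h x : EuclideanSpace ℝ (Fin 5)) 3, (h x : EuclideanSpace ℝ (Fin 5)) 4]) → ∀ (g : Bundle.ContMDiffRiemannianMetric (𝓡 4) (⊤ : ℕ∞) (EuclideanSpace ℝ (Fin 4)) (fun x : M => TangentSpace (𝓡 4) x)), (∀ (x : M) (v w : TangentSpace (𝓡 4) x), g.inner (F x) (mfderiv (𝓡 4) (𝓡 4) F x v) (mfderiv (𝓡 4) (𝓡 4) F x w) = g.inner x v w) → ∃ Φ : Circle × Circle → M → M, ContMDiff (((𝓡 1).prod (𝓡 1)).prod (𝓡 4)) (𝓡 4) (⊤ : ℕ∞) (fun p : (Circle × Circle) × M => Φ p.1 p.2) ∧ ∀ (z w : Circle) (x : M), ((h (Φ (z, w) x) : Metric.sphere (0 : EuclideanSpace ℝ (Fin 5))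 1) : EuclideanSpace ℝ (Fin 5)) = WithLp.toLp 2 ![(z : ℂ).re * (h x : EuclideanSpace ℝ (Fin 5)) 0 - (z : ℂ).im * (h x : EuclideanSpace ℝ (Fin 5)) 1, (z : ℂ).im * (h x : EuclideanSpace ℝ (Fin 5)) 0 + (z : ℂ).re * (h x : EuclideanSpace ℝ (Fin 5)) 1, (w : ℂ).re * (h x : EuclideanSpace ℝ (Fin 5)) 2 - (w : ℂ).im * (h x : EuclideanSpace ℝ (Fin 5)) 3, (w : ℂ).im * (h x : EuclideanSpace ℝ (Fin 5)) 2 + (w : ℂ).re * (h x : EuclideanSpace ℝ (Fin 5)) 3, (h x : EuclideanSpace ℝ (Fin 5)) 4])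
    (h₃ :
      ∀ (M : Type) [TopologicalSpace M] [T2Space M] [SecondCountableTopology M] [ChartedSpace (EuclideanSpace ℝ (Fin 4)) M] [IsManifold (𝓡 4) (⊤ : ℕ∞) M] (F : Diffeomorph (𝓡 4) (𝓡 4) M M (⊤ : ℕ∞)) (h : M ≃ₜ Metric.sphere (0 : EuclideanSpace ℝ (Fin 5)) 1) (α β : ℝ), (∀ x : M, ((h (F x) : Metric.sphere (0 : EuclideanSpace ℝ (Fin 5)) 1) : EuclideanSpace ℝ (Fin 5)) = WithLp.toLp 2 ![Real.cos (2 * Real.pi * α) * (h x : EuclideanSpace ℝ (Fin 5)) 0 - Real.sin (2 * Real.pi * α) * (h x : EuclideanSpace ℝ (Fin 5)) 1, Real.sin (2 * Real.pi * α) * (h x : EuclideanSpace ℝ (Fin 5)) 0 + Real.cos (2 * Real.pi * α) * (h x : EuclideanSpace ℝ (Fin 5)) 1, Real.cos (2 * Real.pi * β) * (h x : EuclideanSpace ℝ (Fin 5)) 2 - Real.sin (2 * Real.pi * β) * (h x : EuclideanSpace ℝ (Fin 5)) 3, Real.sin (2 * Real.pi * β) * (h x : EuclideanSpace ℝ (Fin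 5)) 2 + Real.cos (2 * Real.pi * β) * (h x : EuclideanSpace ℝ (Fin 5)) 3, (h x : EuclideanSpace ℝ (Fin 5)) 4]) → ∀ (Φ : Circle × Circle → M → M), ContMDiff (((𝓡 1).prod (𝓡 1)).prod (𝓡 4)) (𝓡 4) (⊤ : ℕ∞) (fun p : (Circle × Circle) × M => Φ p.1 p.2) → (∀ (z w : Circle) (x : M), ((h (Φ (z, w) x) : Metric.sphere (0 : EuclideanSpace ℝ (Fin 5)) 1) : EuclideanSpace ℝ (Fin 5)) = WithLp.toLp 2 ![(z : ℂ).re * (h x : EuclideanSpace ℝ (Fin 5)) 0 - (z : ℂ).im * (h x : EuclideanSpace ℝ (Fin 5)) 1, (z : ℂ).im * (h x : EuclideanSpace ℝ (Fin 5)) 0 + (z : ℂ).re * (h x : EuclideanSpace ℝ (Fin 5)) 1, (w : ℂ).re * (h x : EuclideanSpace ℝ (Fin 5)) 2 - (w : ℂ).im * (h x : EuclideanSpace ℝ (Fin 5)) 3, (w : ℂ).im * (h x : EuclideanSpace ℝ (Fin 5)) 2 + (w : ℂ).re * (h x : EuclideanSpace ℝ (Fin 5)) 3, (h x : EuclideanSpace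 ℝ (Fin 5)) 4]) → ∃ θ : Diffeomorph (𝓡 4) (𝓡 4) M (Metric.sphere (0 : EuclideanSpace ℝ (Fin 5)) 1) (⊤ : ℕ∞), ∀ x : M, ((θ (F x) : Metric.sphere (0 : EuclideanSpace ℝ (Fin 5)) 1) : EuclideanSpace ℝ (Fin 5)) = WithLp.toLp 2 ![Real.cos (2 * Real.pi * α) * (θ x : EuclideanSpace ℝ (Fin 5)) 0 - Real.sin (2 * Real.pi * α) * (θ x : EuclideanSpace ℝ (Fin 5)) 1, Real.sin (2 * Real.pi * α) * (θ x : EuclideanSpace ℝ (Fin 5)) 0 + Real.cos (2 * Real.pi * α) * (θ x : EuclideanSpace ℝ (Fin 5)) 1, Real.cos (2 * Real.pi * β) * (θ x : EuclideanSpace ℝ (Fin 5)) 2 - Real.sin (2 * Real.pi * β) * (θ x : EuclideanSpace ℝ (Fin 5)) 3, Real.sin (2 * Real.pi * β) * (θ x : EuclideanSpace ℝ (Fin 5)) 2 + Real.cos (2 * Real.pi * β) * (θ x : EuclideanSpace ℝ (Fin 5)) 3, (θ x : EuclideanSpace ℝ (Fin 5)) 4]) :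
    ∀ (M : Type) [TopologicalSpace M] [T2Space M] [SecondCountableTopology M] [ChartedSpace (EuclideanSpace ℝ (Fin 4)) M] [IsManifold (𝓡 4) (⊤ : ℕ∞) M] (F : Diffeomorph (𝓡 4) (𝓡 4) M M (⊤ : ℕ∞)) (h : M ≃ₜ Metric.sphere (0 : EuclideanSpace ℝ (Fin 5)) 1) (α β : ℝ), (∃ γ τ : ℝ, 0 < γ ∧ ∀ k₁ k₂ m : ℤ, (k₁ ≠ 0 ∨ k₂ ≠ 0) → γ ≤ |(k₁ : ℝ) * α + (k₂ : ℝ) * β + (m : ℝ)| * (|(k₁ : ℝ)| + |(k₂ : ℝ)|) ^ τ) → (∀ x : M, ((h (F x) : Metric.sphere (0 : EuclideanSpace ℝ (Fin 5)) 1) : EuclideanSpace ℝ (Fin 5)) = WithLp.toLp 2 ![Real.cos (2 * Real.pi * α) * (h x : EuclideanSpace ℝ (Fin 5)) 0 - Real.sin (2 * Real.pi * α) * (h x : EuclideanSpace ℝ (Fin 5)) 1, Real.sin (2 * Real.pi * α) * (h x : EuclideanSpace ℝ (Fin 5)) 0 + Real.cos (2 * Real.pi * α) * (h x : EuclideanSpace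 ℝ (Fin 5)) 1, Real.cos (2 * Real.pi * β) * (h x : EuclideanSpace ℝ (Fin 5)) 2 - Real.sin (2 * Real.pi * β) * (h x : EuclideanSpace ℝ (Fin 5)) 3, Real.sin (2 * Real.pi * β) * (h x : EuclideanSpace ℝ (Fin 5)) 2 + Real.cos (2 * Real.pi * β) * (h x : EuclideanSpace ℝ (Fin 5)) 3, (h x : EuclideanSpace ℝ (Fin 5)) 4]) → ∃ θ : Diffeomorph (𝓡 4) (𝓡 4) M (Metric.sphere (0 : EuclideanSpace ℝ (Fin 5)) 1) (⊤ : ℕ∞), ∀ x : M, ((θ (F x) : Metric.sphere (0 : EuclideanSpace ℝ (Fin 5)) 1) : EuclideanSpace ℝ (Fin 5)) = WithLp.toLp 2 ![Real.cos (2 * Real.pi * α) * (θ x : EuclideanSpace ℝ (Fin 5)) 0 - Real.sin (2 * Real.pi * α) * (θ x : EuclideanSpace ℝ (Fin 5)) 1, Real.sin (2 * Real.pi * α) * (θ x : EuclideanSpace ℝ (Fin 5)) 0 + Real.cos (2 * Real.pi * α) * (θ x : EuclideanSpace ℝ (Fin 5)) 1, Real.cos (2 * Real.pi * β) * (θ x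 : EuclideanSpace ℝ (Fin 5)) 2 - Real.sin (2 * Real.pi * β) * (θ x : EuclideanSpace ℝ (Fin 5)) 3, Real.sin (2 * Real.pi * β) * (θ x : EuclideanSpace ℝ (Fin 5)) 2 + Real.cos (2 * Real.pi * β) * (θ x : EuclideanSpace ℝ (Fin 5)) 3, (θ x : EuclideanSpace ℝ (Fin 5)) 4] := by
  intro M _ _ _ _ _ F h α β hD hc
  obtain ⟨g, hg⟩ := h₁ M F h α β hD hc
  obtain ⟨Φ, hΦs, hΦh⟩ := h₂ M F h α β hD hc g hg
  exact h₃ M F h α β hc Φ hΦs hΦh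

/-- **`DiophantineRigidity_of` — THE SKELETON**: the crux `DiophantineRotations.DiophantineRigidity` BY NAME,
closed modulo the three registered stubs (D-0027 §3.3 shape `<Crux>_proof := crux_of stub₁ stub₂ stub₃`).
Becomes the crux proof when the stubs are discharged. -/
theorem DiophantineRigidity_of : Summit.SmoothPoincare4.SmoothPoincare4.Theses.DiophantineRotations.DiophantineRigidity :=
  diophantineRigidity_of_stubs stub_isometrisation stub_torusExtension stub_equivariantLinearisation

/-- BC3 letter: `<stub₁-sig> → <stub₂-sig> → <stub₃-sig> → DiophantineRigidity` with the crux BY NAME (an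
`example`, so that `DiophantineRigidity_of` stays the only by-name candidate the skeleton audit sees). -/
example :
    (∀ (M : Type) [TopologicalSpace M] [T2Space M] [SecondCountableTopology M] [ChartedSpace (EuclideanSpace ℝ (Fin 4)) M] [IsManifold (𝓡 4) (⊤ : ℕ∞) M] (F : Diffeomorph (𝓡 4) (𝓡 4) M M (⊤ : ℕ∞)) (h : M ≃ₜ Metric.sphere (0 : EuclideanSpace ℝ (Fin 5)) 1) (α β : ℝ), (∃ γ τ : ℝ, 0 < γ ∧ ∀ k₁ k₂ m : ℤ, (k₁ ≠ 0 ∨ k₂ ≠ 0) → γ ≤ |(k₁ : ℝ) * α + (k₂ : ℝ) * β + (m : ℝ)| * (|(k₁ : ℝ)| + |(k₂ : ℝ)|) ^ τ) → (∀ x : M, ((h (F x) : Metric.sphere (0 : EuclideanSpace ℝ (Fin 5)) 1) : EuclideanSpace ℝ (Fin 5)) = WithLp.toLp 2 ![Real.cos (2 * Real.pi * α) * (h x : EuclideanSpace ℝ (Fin 5)) 0 - Real.sin (2 * Real.pi * α) * (h x : EuclideanSpace ℝ (Fin 5)) 1, Real.sin (2 * Real.pi * α) * (h x : EuclideanSpace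 ℝ (Fin 5)) 0 + Real.cos (2 * Real.pi * α) * (h x : EuclideanSpace ℝ (Fin 5)) 1, Real.cos (2 * Real.pi * β) * (h x : EuclideanSpace ℝ (Fin 5)) 2 - Real.sin (2 * Real.pi * β) * (h x : EuclideanSpace ℝ (Fin 5)) 3, Real.sin (2 * Real.pi * β) * (h x : EuclideanSpace ℝ (Fin 5)) 2 + Real.cos (2 * Real.pi * β) * (h x : EuclideanSpace ℝ (Fin 5)) 3, (h x : EuclideanSpace ℝ (Fin 5)) 4]) → ∃ g : Bundle.ContMDiffRiemannianMetric (𝓡 4) (⊤ : ℕ∞) (EuclideanSpace ℝ (Fin 4)) (fun x : M => TangentSpace (𝓡 4) x), ∀ (x : M) (v w : TangentSpace (𝓡 4) x), g.inner (F x) (mfderiv (𝓡 4) (𝓡 4) F x v) (mfderiv (𝓡 4) (𝓡 4) F x w) = g.inner x v w) →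
    (∀ (M : Type) [TopologicalSpace M] [T2Space M] [SecondCountableTopology M] [ChartedSpace (EuclideanSpace ℝ (Fin 4)) M] [IsManifold (𝓡 4) (⊤ : ℕ∞) M] (F : Diffeomorph (𝓡 4) (𝓡 4) M M (⊤ : ℕ∞)) (h : M ≃ₜ Metric.sphere (0 : EuclideanSpace ℝ (Fin 5)) 1) (α β : ℝ), (∃ γ τ : ℝ, 0 < γ ∧ ∀ k₁ k₂ m : ℤ, (k₁ ≠ 0 ∨ k₂ ≠ 0) → γ ≤ |(k₁ : ℝ) * α + (k₂ : ℝ) * β + (m : ℝ)| * (|(k₁ : ℝ)| + |(k₂ : ℝ)|) ^ τ) → (∀ x : M, ((h (F x) : Metric.sphere (0 : EuclideanSpace ℝ (Fin 5)) 1) : EuclideanSpace ℝ (Fin 5)) = WithLp.toLp 2 ![Real.cos (2 * Real.pi * α) * (h x : EuclideanSpace ℝ (Fin 5)) 0 - Real.sin (2 * Real.pi * α) * (h x : EuclideanSpace ℝ (Fin 5)) 1, Real.sin (2 * Real.pi * α) * (h x : EuclideanSpace ℝ (Fin 5)) 0 + Real.cos (2 * Real.pi * α) * (h x : EuclideanSpace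 ℝ (Fin 5)) 1, Real.cos (2 * Real.pi * β) * (h x : EuclideanSpace ℝ (Fin 5)) 2 - Real.sin (2 * Real.pi * β) * (h x : EuclideanSpace ℝ (Fin 5)) 3, Real.sin (2 * Real.pi * β) * (h x : EuclideanSpace ℝ (Fin 5)) 2 + Real.cos (2 * Real.pi * β) * (h x : EuclideanSpace ℝ (Fin 5)) 3, (h x : EuclideanSpace ℝ (Fin 5)) 4]) → ∀ (g : Bundle.ContMDiffRiemannianMetric (𝓡 4) (⊤ : ℕ∞) (EuclideanSpace ℝ (Fin 4)) (fun x : M => TangentSpace (𝓡 4) x)), (∀ (x : M) (v w : TangentSpace (𝓡 4) x), g.inner (F x) (mfderiv (𝓡 4) (𝓡 4) F x v) (mfderiv (𝓡 4) (𝓡 4) F x w) = g.inner x v w) → ∃ Φ : Circle × Circle → M → M, ContMDiff (((𝓡 1).prod (𝓡 1)).prod (𝓡 4)) (𝓡 4) (⊤ : ℕ∞) (fun p : (Circle × Circle) × M => Φ p.1 p.2) ∧ ∀ (z w : Circle) (x : M), ((h (Φ (z, w) x) : Metric.sphere (0 : EuclideanSpace ℝ (Fin 5)) 1) : EuclideanSpace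 ℝ (Fin 5)) = WithLp.toLp 2 ![(z : ℂ).re * (h x : EuclideanSpace ℝ (Fin 5)) 0 - (z : ℂ).im * (h x : EuclideanSpace ℝ (Fin 5)) 1, (z : ℂ).im * (h x : EuclideanSpace ℝ (Fin 5)) 0 + (z : ℂ).re * (h x : EuclideanSpace ℝ (Fin 5)) 1, (w : ℂ).re * (h x : EuclideanSpace ℝ (Fin 5)) 2 - (w : ℂ).im * (h x : EuclideanSpace ℝ (Fin 5)) 3, (w : ℂ).im * (h x : EuclideanSpace ℝ (Fin 5)) 2 + (w : ℂ).re * (h x : EuclideanSpace ℝ (Fin 5)) 3, (h x : EuclideanSpace ℝ (Fin 5)) 4]) →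
    (∀ (M : Type) [TopologicalSpace M] [T2Space M] [SecondCountableTopology M] [ChartedSpace (EuclideanSpace ℝ (Fin 4)) M] [IsManifold (𝓡 4) (⊤ : ℕ∞) M] (F : Diffeomorph (𝓡 4) (𝓡 4) M M (⊤ : ℕ∞)) (h : M ≃ₜ Metric.sphere (0 : EuclideanSpace ℝ (Fin 5)) 1) (α β : ℝ), (∀ x : M, ((h (F x) : Metric.sphere (0 : EuclideanSpace ℝ (Fin 5)) 1) : EuclideanSpace ℝ (Fin 5)) = WithLp.toLp 2 ![Real.cos (2 * Real.pi * α) * (h x : EuclideanSpace ℝ (Fin 5)) 0 - Real.sin (2 * Real.pi * α) * (h x : EuclideanSpace ℝ (Fin 5)) 1, Real.sin (2 * Real.pi * α) * (h x : EuclideanSpace ℝ (Fin 5)) 0 + Real.cos (2 * Real.pi * α) * (h x : EuclideanSpace ℝ (Fin 5)) 1, Real.cos (2 * Real.pi * β) * (h x : EuclideanSpace ℝ (Fin 5)) 2 - Real.sin (2 * Real.pi * β) * (h x : EuclideanSpace ℝ (Fin 5)) 3, Real.sin (2 * Real.pi * β) * (h x : EuclideanSpace ℝ (Fin 5)) 2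 + Real.cos (2 * Real.pi * β) * (h x : EuclideanSpace ℝ (Fin 5)) 3, (h x : EuclideanSpace ℝ (Fin 5)) 4]) → ∀ (Φ : Circle × Circle → M → M), ContMDiff (((𝓡 1).prod (𝓡 1)).prod (𝓡 4)) (𝓡 4) (⊤ : ℕ∞) (fun p : (Circle × Circle) × M => Φ p.1 p.2) → (∀ (z w : Circle) (x : M), ((h (Φ (z, w) x) : Metric.sphere (0 : EuclideanSpace ℝ (Fin 5)) 1) : EuclideanSpace ℝ (Fin 5)) = WithLp.toLp 2 ![(z : ℂ).re * (h x : EuclideanSpace ℝ (Fin 5)) 0 - (z : ℂ).im * (h x : EuclideanSpace ℝ (Fin 5)) 1, (z : ℂ).im * (h x : EuclideanSpace ℝ (Fin 5)) 0 + (z : ℂ).re * (h x : EuclideanSpace ℝ (Fin 5)) 1, (w : ℂ).re * (h x : EuclideanSpace ℝ (Fin 5)) 2 - (w : ℂ).im * (h x : EuclideanSpace ℝ (Fin 5)) 3, (w : ℂ).im * (h x : EuclideanSpace ℝ (Fin 5)) 2 + (w : ℂ).re * (h x : EuclideanSpace ℝ (Fin 5)) 3, (h x : EuclideanSpace ℝ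 (Fin 5)) 4]) → ∃ θ : Diffeomorph (𝓡 4) (𝓡 4) M (Metric.sphere (0 : EuclideanSpace ℝ (Fin 5)) 1) (⊤ : ℕ∞), ∀ x : M, ((θ (F x) : Metric.sphere (0 : EuclideanSpace ℝ (Fin 5)) 1) : EuclideanSpace ℝ (Fin 5)) = WithLp.toLp 2 ![Real.cos (2 * Real.pi * α) * (θ x : EuclideanSpace ℝ (Fin 5)) 0 - Real.sin (2 * Real.pi * α) * (θ x : EuclideanSpace ℝ (Fin 5)) 1, Real.sin (2 * Real.pi * α) * (θ x : EuclideanSpace ℝ (Fin 5)) 0 + Real.cos (2 * Real.pi * α) * (θ x : EuclideanSpace ℝ (Fin 5)) 1, Real.cos (2 * Real.pi * β) * (θ x : EuclideanSpace ℝ (Fin 5)) 2 - Real.sin (2 * Real.pi * β) * (θ x : EuclideanSpace ℝ (Fin 5)) 3, Real.sin (2 * Real.pi * β) * (θ x : EuclideanSpace ℝ (Fin 5)) 2 + Real.cos (2 * Real.pi * β) * (θ x : EuclideanSpace ℝ (Fin 5)) 3, (θ x : EuclideanSpace ℝ (Fin 5)) 4]) →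
    Summit.SmoothPoincare4.SmoothPoincare4.Theses.DiophantineRotations.DiophantineRigidity :=
  diophantineRigidity_of_stubs

end Summit.SmoothPoincare4.SmoothPoincare4.Cruxes.DiophantineRigidity.Birth
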